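import Literature.NumberTheory.LFunctions.FordProgram1Run42A
import Literature.NumberTheory.LFunctions.FordProgram1Run42B
import Literature.NumberTheory.LFunctions.FordProgram1Run42C
import HarnessLib

/-!
# Ford's "Program 1": kernel run 42 (`1173 ≤ k ≤ 1190`)

Topic `Literature/NumberTheory/LFunctions`. Everything here is PROVED (standard axioms):
`FordP1.checkT k = true` for `1173 ≤ k ≤ 1190`, i.e. the certified re-run of PROGRAM 1 of
K. Ford, Proc. LMS 85 (2002) (the second part of Theorem 3) for these `k` — see `FordProgram1.lean`
for the checker, its soundness `FordP1.row_of_checkK`, and the meaning of the constants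
(`ρ = FordP1.rhoOf k / 10⁵`, `θ = FordP1.thetaOf k / 10⁴`, `ω = FordP1.omOf k / 10⁴`).

The kernel evaluations themselves (one `decide +kernel` per `k`, so that the kernel's evaluation
state is bounded by a single run) live in
`FordProgram1Run42A.lean` (`1173 ≤ k ≤ 1178`),
`FordProgram1Run42B.lean` (`1179 ≤ k ≤ 1184`),
`FordProgram1Run42C.lean` (`1185 ≤ k ≤ 1190`);
the original single `decide` over all `18` values exceeded the full build's resources. This file
only assembles them into the range statement `FordP1.run42` (statement unchanged), which the
assembly `FordTheorem3SmallK.lean` consumes.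

## References

* K. Ford, Proc. London Math. Soc. (3) 85 (2002), 565–633; arXiv:1910.08209: Theorem 3, (1.7),
  Lemmas 3.4–3.5, Appendix "PROGRAM 1". [Ford2002]
-/

namespace Literature.NumberTheory.LFunctions
namespace FordP1

/-- **Kernel run 42**: `checkT k` for `1173 ≤ k ≤ 1190` (assembled from the runs 42A, 42B, 42C).
[cite: Ford2002, Theorem 3 (second part) and PROGRAM 1] -/
theorem run42 : ((List.range' 1173 18).all checkT) = true := by
  rw [List.all_eq_true]
  intro k hk
  rw [List.mem_range'_1] at hk
  rcases hk with ⟨h1, h2⟩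
  rcases lt_or_ge k 1179 with hlt0 | hge0
  · exact run42A k h1 (by omega)
  rcases lt_or_ge k 1185 with hlt1 | hge1
  · exact run42B k hge0 (by omega)
  · exact run42C k hge1 (by omega)

end FordP1
end Literature.NumberTheory.LFunctions
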